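import Literature.NumberTheory.ComplexMultiplication.FiniteQAlgebraLatticeLocalUnits
import Mathlib.RingTheory.Norm.Basic
import Mathlib.LinearAlgebra.Charpoly.ToMatrix
import Mathlib.LinearAlgebra.Matrix.Charpoly.Coeff
import Mathlib.RingTheory.Polynomial.Tower
import HarnessLib

/-!
# THE DETERMINANT CRITERION FOR LOCAL UNITS of an order `Λ` in an ARBITRARY finite-dimensional commutative
# `ℚ`-algebra `A`: for `a ∈ Λ`, `det(a) := det(μ_a : A → A) = N_{A/ℚ}(a)` is an INTEGER, and
# `a ∈ Λ_(p)^{unit} ⟺ p ∤ det(a)`; for `a ∈ Λ_(p)`, `a ∈ Λ_(p)^{unit} ⟺ det(a) ∈ ℤ_(p)^{unit}`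
# (Hertling–Larabi 2026 Lemma 7.5 (a) and the first lines of the proof of (b), by Cayley–Hamilton ∕ the adjugate);
# globally `a ∈ Λ^{unit} ⟺ det(a) = ±1` and `a ∈ A^{unit} ⟺ det(a) ≠ 0` — nilpotents allowed

[topic NumberTheory/ComplexMultiplication] General-`A` series (namespace
`Literature.NumberTheory.ComplexMultiplication.FiniteQAlgebraLattice`); sequel of `FiniteQAlgebraLatticeLocalUnits`
(Lemma 7.5 (b) ∕ Rem. 7.7 by Nakayama: the def-free local units «`a ∈ Λ_(p)^{unit}`» =
`∃ b ∈ Λ, ∃ r : ℤ, ¬ ↑p ∣ r ∧ a·b = r·1`, «`a + pΛ ∈ (Λ/pΛ)^{unit}`» = `∃ b ∈ Λ, ∃ c ∈ Λ, a·b = 1 + p·c`,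
`exists_mul_eq_smul_one_iff_exists_mul_eq_one_add` — REUSED by name) and of `FiniteQAlgebraLatticePowersInvertible`
(`exists_basis_fin_span_eq`: a full lattice is `⊕_j ℤω_j` on a `ℚ`-basis `ω` of `A`).  This file supplies what
`FiniteQAlgebraLatticeLocalUnits` lists as NOT there: LEMMA 7.5 (a), HL's own DETERMINANT criterion, with
`det(a)` written as Mathlib's `Algebra.norm ℚ a` (`= LinearMap.det (Algebra.lmul ℚ A a)`, `Algebra.norm_apply`).
Lane `lit-hodgefound` (Track 2 foundations library), seat p19 generation 37, row g37-#1.  THEOREMS ONLY: no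
definition, no instance, no notation, no named fact (D-0026, net Literature debt `0`), no `sorry`.

DEF-FREE SPELLING (continued).  «`det(a) ∈ ℤ`» is `∃ d : ℤ, (d : ℚ) = Algebra.norm ℚ a` and the criteria are
stated for such a `d`; «`det(a) ∈ ℤ_(p)^{unit}`» is `∃ r t : ℤ, ¬ ↑p ∣ r ∧ ¬ ↑p ∣ t ∧ t·det(a) = r`; «`a ∈ Λ_(p)`» is
`∃ s : ℤ, ¬ ↑p ∣ s ∧ s • a ∈ Λ` (as in `FiniteQAlgebraLatticeLocalization`).

## Source, VERBATIM

C. Hertling, K. Larabi, *Semigroups from full lattices in commutative ℚ-algebras*, arXiv:2602.14973 (2026)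
[HertlingLarabi2026], held `paper:arxiv-2602.14973`, §7 (chunks p0018–p0019) — `A` «a finite dimensional
commutative ℚ-algebra with unit element» (Thm. 3.1), not assumed separable: «**Lemma 7.5.** Let `A` be as in
Theorem 3.1. Let `Λ` be an order in `A`. Let `p ∈ ℙ` be a prime number. For any `a ∈ A` `det(a) ∈ ℚ` denotes the
determinant of the endomorphism `(μ_a : A → A, b ↦ ab)` of `A`. (a) Consider an element `a ∈ Λ_(p)`. Then
`a ∈ Λ_(p)^{unit} ⟺ det(a) ∈ ℤ_(p)^{unit}`. (b) Consider an element `a ∈ Λ`. Then `a ∈ Λ_(p)^{unit} ⟺ a + pΛ ∈ Λ/pΛ`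
is in `(Λ/pΛ)^{unit}`. *Proof:* (a) ⇒: `a ∈ Λ_(p)` implies `det(a) ∈ ℤ_(p)`, and `a⁻¹ ∈ Λ_(p)` implies
`(det(a))⁻¹ = det(a⁻¹) ∈ ℤ_(p)`. ⇐: Suppose `det(a) ∈ ℤ_(p)^{unit}`. Denote by `p_{Ch,a}(t) ∈ ℤ[t]` the characteristic
polynomial of the endomorphism `(μ_a : A → A, b ↦ ab)`. Then `p_{Ch,a}(a) = 0` by Cayley-Hamilton, and `t` divides
`p_{Ch,a}(t) − (−1)ⁿdet(a)`, so `b := (p_{Ch,a}(a) − (−1)ⁿdet(a))/a = ((−1)^{n+1}det(a))/a ∈ ℤ[a] ⊂ Λ_(p)`,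
`a⁻¹ = (−1)^{n+1}(det(a))⁻¹·b ∈ Λ_(p)`. (b) Suppose `a ∈ Λ`. Then `det(a) ∈ ℤ`. Then by part (a)
`a ∈ Λ_(p)^{unit} ⟺ p ∤ det(a)`. This is equivalent to `a + pΛ ∈ (Λ/pΛ)^{unit}`. □»  The companion paper
[HertlingLarabi2026b] (arXiv:2602.15748, §7 Rem. 7.3 (ii), chunk p0015) names the same number the NORM:
«The norm `N(a) ∈ ℚ` of an element `a ∈ A` is `N(a) := det((multiplication with a) : A → A)`.»

## What is proved (`M, Λ : Submodule ℤ A`; `Λ` an order: `1 ∈ Λ`, `ΛΛ ⊆ Λ`, full; `p : ℕ` prime; `d : ℤ` with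
## `(d : ℚ) = Algebra.norm ℚ a`)

* §1 «`a ∈ Λ_(p)` implies `det(a) ∈ ℤ_(p)`», integral form, for any full lattice `M` and any `a ∈ 𝒪(M)`
  (`aM ⊆ M`): `exists_leftMulMatrix_eq_map` (the matrix of `μ_a` in a `ℤ`-basis of `M` — a `ℚ`-basis of `A` — is an
  INTEGER matrix), **`exists_intCast_eq_norm`** («Then `det(a) ∈ ℤ`»), the ADJUGATE form of HL's element `b`:
  **`exists_mem_mul_eq_norm_smul`** (for every `x ∈ M` some `y ∈ M` has `a·y = det(a)·x`), and HL's Cayley–Hamilton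
  ingredient **`exists_monic_aeval_eq_zero`** («`p_{Ch,a}(t) ∈ ℤ[t]`», «`p_{Ch,a}(a) = 0`», with constant coefficient
  `(−1)ⁿdet(a)`).
* §2 LEMMA 7.5 for `a ∈ Λ`: «⇒» `not_dvd_of_mul_eq_smul_one` (a local unit has `p ∤ det(a)` — norms are
  multiplicative and `det(r·1_A) = rⁿ`), «⇐» `exists_mul_eq_smul_one_of_not_dvd` (`a·y = det(a)·1_A` with `y ∈ Λ`),
  packaged **`exists_mul_eq_smul_one_iff_not_dvd`** ∕ `exists_mul_eq_smul_one_iff_exists_not_dvd`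
  («`a ∈ Λ_(p)^{unit} ⟺ p ∤ det(a)`»), and through `FiniteQAlgebraLatticeLocalUnits`' Lemma 7.5 (b)
  **`exists_mul_eq_one_add_iff_not_dvd`** («`a + pΛ ∈ (Λ/pΛ)^{unit} ⟺ p ∤ det(a)`»).
* §3 LEMMA 7.5 (a) AS PRINTED, for `a ∈ Λ_(p)`: `exists_mul_eq_smul_one_iff_of_smul` (`a` is a local unit iff `s·a`
  is, `p ∤ s`), `intCast_pow_mul_norm_eq` (`det(s·a) = sⁿdet(a)`), **`exists_mul_eq_smul_one_iff_norm_localUnit`**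
  («`a ∈ Λ_(p)^{unit} ⟺ det(a) ∈ ℤ_(p)^{unit}`»).
* §4 GLOBAL corollaries: **`exists_mul_eq_one_iff_isUnit_norm`** (`a ∈ Λ^{unit} ⟺ det(a) = ±1`, i.e.
  `IsUnit d`; `exists_mul_eq_one_iff_norm_eq_one_or`), `exists_mul_eq_one_iff_forall_prime` (`a ∈ Λ^{unit}` iff
  `a ∈ Λ_(p)^{unit}` for every prime `p`), and in `A` itself **`isUnit_iff_norm_ne_zero`** (`a ∈ A^{unit} ⟺ det(a) ≠ 0`).
NOT here: Thm. 7.6 (`Λ_(p)^{unit} → (Λ_(p)/L_(p))^{unit}` is onto; the `Y`-file `CMAlgebraLatticeOrderExtensionKernel`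
∕ general-`A` `FiniteQAlgebraLatticeOrderExtensionKernel`).

## References
* [HertlingLarabi2026] C. Hertling, K. Larabi, arXiv:2602.14973 (2026), §7 Lemma 7.5 (a), (b) and proof (chunks
  p0018–p0019). [cite: HertlingLarabi2026, §7 Lemma 7.5, chunks p0018–p0019]
* [HertlingLarabi2026b] C. Hertling, K. Larabi, *Conjugacy classes of regular integer matrices*, arXiv:2602.15748
  (2026), §7 Rem. 7.3 (ii) (the norm `N(a) = det(μ_a)`), chunk p0015. [cite: HertlingLarabi2026b, §7 Rem. 7.3 (ii), chunk p0015]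
* [Faddeev1965] D. K. Faddeev, Trudy Mat. Inst. Steklov 80 (1965) 145–182 (the localisations `Λ_(p)`, as cited by
  HL §7). [cite: Faddeev1965, as cited by HertlingLarabi2026 §7]
-/

noncomputable section

open scoped Pointwise
open Module Submodule Polynomial

open Literature.NumberTheory.Automorphic (IsFullLattice)

namespace Literature.NumberTheory.ComplexMultiplication.FiniteQAlgebraLattice

section LocalUnitsNorm

variable {A : Type} [CommRing A] [Algebra ℚ A]

/-! ## §0 Primes of `ℤ` coming from `ℕ` (file-local bookkeeping) -/

/-- `p ∤ s`, `p ∤ s′ ⟹ p ∤ ss′` in `ℤ` (file-local). [folklore] -/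
private theorem not_dvd_mul_int' {p : ℕ} (hp : p.Prime) {s s' : ℤ} (hs : ¬ (p : ℤ) ∣ s) (hs' : ¬ (p : ℤ) ∣ s') :
    ¬ (p : ℤ) ∣ s * s' :=
  fun h => ((Nat.prime_iff_prime_int.1 hp).dvd_or_dvd h).elim hs hs'

/-- `p ∤ s ⟹ p ∤ s^k` in `ℤ` (file-local). [folklore] -/
private theorem not_dvd_pow_int' {p : ℕ} (hp : p.Prime) {s : ℤ} (hs : ¬ (p : ℤ) ∣ s) (k : ℕ) :
    ¬ (p : ℤ) ∣ s ^ k :=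
  fun h => hs ((Nat.prime_iff_prime_int.1 hp).dvd_of_dvd_pow h)

/-- `det(r·1_A) = rⁿ`, `n = dim_ℚ A` (file-local). [folklore] -/
private theorem norm_zsmul_one (r : ℤ) : Algebra.norm ℚ (r • (1 : A)) = (r : ℚ) ^ finrank ℚ A := by
  rw [zsmul_eq_mul, mul_one, ← map_intCast (algebraMap ℚ A) r, Algebra.norm_algebraMap]

/-! ## §1 `a ∈ 𝒪(M)`: the matrix of `μ_a` in a `ℤ`-basis of `M` is an integer matrix, `det(a) ∈ ℤ`,
`a·y = det(a)·x` (adjugate), `p_{Ch,a} ∈ ℤ[t]` with `p_{Ch,a}(a) = 0` (Cayley–Hamilton) -/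

/-- **For `a` with `a·M ⊆ M`, `M = ⊕_i ℤb_i` the `ℤ`-span of a `ℚ`-basis `b` of `A`, the matrix of `μ_a : A → A` in `b` is
an INTEGER matrix** (the coordinates of `a·b_j ∈ M` are integers) — the reason for «`a ∈ Λ_(p)` implies
`det(a) ∈ ℤ_(p)`» and «Suppose `a ∈ Λ`. Then `det(a) ∈ ℤ`». [cite: HertlingLarabi2026, §7 Lemma 7.5 (proof of (a) «⇒» and of (b)), chunks p0018–p0019] -/
theorem exists_leftMulMatrix_eq_map {ι : Type} [Fintype ι] [DecidableEq ι] (b : Basis ι ℚ A) {a : A}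
    (ha : ∀ x ∈ span ℤ (Set.range b), a * x ∈ span ℤ (Set.range b)) :
    ∃ B : Matrix ι ι ℤ, Algebra.leftMulMatrix b a = B.map (Int.castRingHom ℚ) := by
  have h : ∀ i j, ∃ z : ℤ, (z : ℚ) = Algebra.leftMulMatrix b a i j := fun i j => by
    rw [Algebra.leftMulMatrix_eq_repr_mul]
    obtain ⟨z, hz⟩ := (Basis.mem_span_iff_repr_mem ℤ b _).1 (ha _ (subset_span ⟨j, rfl⟩)) i
    exact ⟨z, by rw [← hz, eq_intCast]⟩
  choose B hB using h
  exact ⟨Matrix.of B, by ext i j; rw [Matrix.map_apply, Matrix.of_apply, eq_intCast, hB]⟩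

/-- **«Suppose `a ∈ Λ`. Then `det(a) ∈ ℤ`»** — for every full lattice `M` and every `a ∈ 𝒪(M)` (`a·M ⊆ M`) the
determinant `det(μ_a) = N_{A/ℚ}(a)` is an integer. [cite: HertlingLarabi2026, §7 Lemma 7.5 (proof of (b)), chunk p0019] -/
theorem exists_intCast_eq_norm {M : Submodule ℤ A} (hM : IsFullLattice A M) {a : A}
    (ha : ∀ x ∈ M, a * x ∈ M) : ∃ d : ℤ, (d : ℚ) = Algebra.norm ℚ a := by
  obtain ⟨b, hb⟩ := exists_basis_fin_span_eq hM
  subst hb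
  obtain ⟨B, hB⟩ := exists_leftMulMatrix_eq_map b ha
  exact ⟨B.det, by rw [Algebra.norm_eq_matrix_det b, hB, ← RingHom.mapMatrix_apply, ← RingHom.map_det, eq_intCast]⟩

/-- **The ADJUGATE form of HL's element `b = (−1)^{n+1}det(a)/a`: for a full lattice `M`, `a ∈ 𝒪(M)` and every
`x ∈ M` there is `y ∈ M` with `a·y = det(a)·x`** (the vector of coordinates of `y` is `adj(B)` applied to that of `x`,
`B` the integer matrix of `μ_a`; `B·adj(B) = det(B)·1`).  With `x = 1_A ∈ Λ` this is «`a⁻¹ = (−1)^{n+1}(det(a))⁻¹·b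
∈ Λ_(p)`». [cite: HertlingLarabi2026, §7 Lemma 7.5 (proof of (a) «⇐»), chunk p0018] -/
theorem exists_mem_mul_eq_norm_smul {M : Submodule ℤ A} (hM : IsFullLattice A M) {a : A}
    (ha : ∀ x ∈ M, a * x ∈ M) {x : A} (hx : x ∈ M) :
    ∃ y ∈ M, a * y = Algebra.norm ℚ a • x := by
  obtain ⟨b, hb⟩ := exists_basis_fin_span_eq hM
  subst hb
  obtain ⟨B, hB⟩ := exists_leftMulMatrix_eq_map b ha
  -- the coordinates of `x` are integers
  have hxz : ∀ j, ∃ z : ℤ, (z : ℚ) = b.repr x j := fun j => by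
    obtain ⟨z, hz⟩ := (Basis.mem_span_iff_repr_mem ℤ b _).1 hx j
    exact ⟨z, by rw [← hz, eq_intCast]⟩
  choose z hz using hxz
  -- `y` := the vector with coordinates `adj(B)·(coordinates of x)`
  refine ⟨∑ i, ((Algebra.leftMulMatrix b a).adjugate.mulVec (b.repr x : Fin (finrank ℚ A) → ℚ)) i • b i,
    ?_, ?_⟩
  · refine (Basis.mem_span_iff_repr_mem ℤ b _).2 fun i => ⟨∑ j, B.adjugate i j * z j, ?_⟩
    rw [b.repr_sum_self, hB, ← RingHom.mapMatrix_apply, ← RingHom.map_adjugate, RingHom.mapMatrix_apply,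
      eq_intCast]
    simp only [Matrix.mulVec, dotProduct, Matrix.map_apply, eq_intCast, Int.cast_sum, Int.cast_mul, hz]
  · apply b.repr.injective
    apply DFunLike.coe_injective
    rw [← Algebra.leftMulMatrix_mulVec_repr, b.repr_sum_self, Matrix.mulVec_mulVec, Matrix.mul_adjugate,
      Matrix.smul_mulVec, Matrix.one_mulVec, ← Algebra.norm_eq_matrix_det b, map_smul, Finsupp.coe_smul]

/-- **«Denote by `p_{Ch,a}(t) ∈ ℤ[t]` the characteristic polynomial of the endomorphism `μ_a` […] Then `p_{Ch,a}(a) = 0`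
by Cayley-Hamilton», and its constant coefficient is `(−1)ⁿdet(a)`** — for every full lattice `M` and `a ∈ 𝒪(M)`:
a MONIC integer polynomial `P` with `P ⊗ ℚ = charpoly(μ_a)`, `P(a) = 0`, `(−1)ⁿP(0) = det(a)`, `n = dim_ℚ A`.
[cite: HertlingLarabi2026, §7 Lemma 7.5 (proof of (a) «⇐»), chunk p0018] -/
theorem exists_monic_aeval_eq_zero [Module.Finite ℚ A] {M : Submodule ℤ A} (hM : IsFullLattice A M) {a : A}
    (ha : ∀ x ∈ M, a * x ∈ M) :
    ∃ P : ℤ[X], P.Monic ∧ P.map (Int.castRingHom ℚ) = (Algebra.lmul ℚ A a).charpoly ∧ aeval a P = 0 ∧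
      (-1 : ℚ) ^ finrank ℚ A * (P.coeff 0 : ℚ) = Algebra.norm ℚ a := by
  obtain ⟨b, hb⟩ := exists_basis_fin_span_eq hM
  subst hb
  obtain ⟨B, hB⟩ := exists_leftMulMatrix_eq_map b ha
  have hmap : B.charpoly.map (Int.castRingHom ℚ) = (Algebra.lmul ℚ A a).charpoly := by
    rw [← Matrix.charpoly_map, ← hB, Algebra.leftMulMatrix_apply, LinearMap.charpoly_toMatrix]
  refine ⟨B.charpoly, Matrix.charpoly_monic B, hmap, ?_, ?_⟩
  · -- Cayley–Hamilton for `μ_a`, evaluated at `1_A`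
    have h1 : aeval a ((Algebra.lmul ℚ A a).charpoly) = 0 := by
      have h2 : Algebra.lmul ℚ A (aeval a ((Algebra.lmul ℚ A a).charpoly)) = 0 := by
        rw [← Polynomial.aeval_algHom_apply, LinearMap.aeval_self_charpoly]
      simpa using LinearMap.congr_fun h2 1
    rw [← Polynomial.aeval_map_algebraMap ℚ, algebraMap_int_eq, hmap, h1]
  · rw [Algebra.norm_eq_matrix_det b, hB, ← RingHom.mapMatrix_apply, ← RingHom.map_det, eq_intCast,
      Matrix.det_eq_sign_charpoly_coeff, Fintype.card_fin, Int.cast_mul, Int.cast_pow, Int.cast_neg, Int.cast_one]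

/-! ## §2 Lemma 7.5 for `a ∈ Λ`: `a ∈ Λ_(p)^{unit} ⟺ p ∤ det(a)` -/

/-- **LEMMA 7.5 «⇒» for `a` with `det(a) = d ∈ ℤ`: if `a·b = r·1_A` with `b ∈ Λ` (`Λ` a full order) and `p ∤ r`,
then `p ∤ det(a)`** («`a⁻¹ ∈ Λ_(p)` implies `(det(a))⁻¹ = det(a⁻¹) ∈ ℤ_(p)`»: here `det(a)·det(b) = det(r·1_A) = rⁿ`
with `det(b) ∈ ℤ`). [cite: HertlingLarabi2026, §7 Lemma 7.5 (a) «⇒», chunk p0018] -/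
theorem not_dvd_of_mul_eq_smul_one {Λ : Submodule ℤ A} (hΛ : IsFullLattice A Λ) (hΛΛ : Λ * Λ ≤ Λ)
    {p : ℕ} (hp : p.Prime) {a b : A} (hb : b ∈ Λ) {r : ℤ} (hr : ¬ (p : ℤ) ∣ r)
    (hab : a * b = r • (1 : A)) {d : ℤ} (hd : (d : ℚ) = Algebra.norm ℚ a) : ¬ (p : ℤ) ∣ d := by
  obtain ⟨d', hd'⟩ := exists_intCast_eq_norm hΛ (a := b) fun x hx => hΛΛ (Submodule.mul_mem_mul hb hx)
  have h : d * d' = r ^ finrank ℚ A := by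
    have h1 := congrArg (Algebra.norm ℚ) hab
    rw [map_mul, norm_zsmul_one, ← hd, ← hd'] at h1
    exact_mod_cast h1
  intro hpd
  refine not_dvd_pow_int' hp hr (finrank ℚ A) ?_
  rw [← h]
  exact dvd_mul_of_dvd_left hpd d'

/-- **LEMMA 7.5 «⇐» for `a ∈ Λ` with `det(a) = d`, `p ∤ d`: `a` is a unit of `Λ_(p)`** — `a·y = det(a)·1_A` with
`y ∈ Λ` (§1, the adjugate ∕ Cayley–Hamilton element «`b = (−1)^{n+1}det(a)/a ∈ ℤ[a] ⊂ Λ_(p)`»).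
[cite: HertlingLarabi2026, §7 Lemma 7.5 (a) «⇐», chunk p0018] -/
theorem exists_mul_eq_smul_one_of_not_dvd {Λ : Submodule ℤ A} (hΛ : IsFullLattice A Λ) (h1 : (1 : A) ∈ Λ)
    (hΛΛ : Λ * Λ ≤ Λ) {p : ℕ} {a : A} (ha : a ∈ Λ) {d : ℤ} (hd : (d : ℚ) = Algebra.norm ℚ a)
    (hpd : ¬ (p : ℤ) ∣ d) : ∃ b ∈ Λ, ∃ r : ℤ, ¬ (p : ℤ) ∣ r ∧ a * b = r • (1 : A) := by
  obtain ⟨y, hy, hay⟩ :=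
    exists_mem_mul_eq_norm_smul hΛ (a := a) (fun x hx => hΛΛ (Submodule.mul_mem_mul ha hx)) h1
  exact ⟨y, hy, d, hpd, by rw [hay, ← hd, Int.cast_smul_eq_zsmul]⟩

/-- **LEMMA 7.5 for `a ∈ Λ`: «`a ∈ Λ_(p)^{unit} ⟺ p ∤ det(a)`»** (`Λ` a full order, `d = det(a) ∈ ℤ`).
[cite: HertlingLarabi2026, §7 Lemma 7.5 (a) and proof of (b) («Then by part (a) `a ∈ Λ_(p)^{unit} ⟺ p ∤ det(a)`»), chunks p0018–p0019] -/
theorem exists_mul_eq_smul_one_iff_not_dvd {Λ : Submodule ℤ A} (hΛ : IsFullLattice A Λ) (h1 : (1 : A) ∈ Λ)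
    (hΛΛ : Λ * Λ ≤ Λ) {p : ℕ} (hp : p.Prime) {a : A} (ha : a ∈ Λ) {d : ℤ} (hd : (d : ℚ) = Algebra.norm ℚ a) :
    (∃ b ∈ Λ, ∃ r : ℤ, ¬ (p : ℤ) ∣ r ∧ a * b = r • (1 : A)) ↔ ¬ (p : ℤ) ∣ d :=
  ⟨fun ⟨_, hb, _, hr, hab⟩ => not_dvd_of_mul_eq_smul_one hΛ hΛΛ hp hb hr hab hd,
    exists_mul_eq_smul_one_of_not_dvd hΛ h1 hΛΛ ha hd⟩

/-- **LEMMA 7.5 for `a ∈ Λ`, self-contained form: `a ∈ Λ_(p)^{unit}` iff `det(a)` is an integer prime to `p`.**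
[cite: HertlingLarabi2026, §7 Lemma 7.5 (a) and proof of (b), chunks p0018–p0019] -/
theorem exists_mul_eq_smul_one_iff_exists_not_dvd {Λ : Submodule ℤ A} (hΛ : IsFullLattice A Λ)
    (h1 : (1 : A) ∈ Λ) (hΛΛ : Λ * Λ ≤ Λ) {p : ℕ} (hp : p.Prime) {a : A} (ha : a ∈ Λ) :
    (∃ b ∈ Λ, ∃ r : ℤ, ¬ (p : ℤ) ∣ r ∧ a * b = r • (1 : A)) ↔
      ∃ d : ℤ, (d : ℚ) = Algebra.norm ℚ a ∧ ¬ (p : ℤ) ∣ d := by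
  obtain ⟨d, hd⟩ := exists_intCast_eq_norm hΛ (a := a) fun x hx => hΛΛ (Submodule.mul_mem_mul ha hx)
  rw [exists_mul_eq_smul_one_iff_not_dvd hΛ h1 hΛΛ hp ha hd]
  refine ⟨fun h => ⟨d, hd, h⟩, fun ⟨d', hd', h'⟩ => ?_⟩
  have hdd' : d = d' := by exact_mod_cast hd.trans hd'.symm
  rwa [hdd']

/-- **LEMMA 7.5 (b) with the determinant: for `a ∈ Λ`, «`a + pΛ ∈ (Λ/pΛ)^{unit}`» ⟺ `p ∤ det(a)`** (through
`FiniteQAlgebraLatticeLocalUnits`' `a ∈ Λ_(p)^{unit} ⟺ a + pΛ ∈ (Λ/pΛ)^{unit}`).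
[cite: HertlingLarabi2026, §7 Lemma 7.5 (b) and proof («This is equivalent to `a + pΛ ∈ (Λ/pΛ)^{unit}`»), chunk p0019] -/
theorem exists_mul_eq_one_add_iff_not_dvd {Λ : Submodule ℤ A} (hΛ : IsFullLattice A Λ) (h1 : (1 : A) ∈ Λ)
    (hΛΛ : Λ * Λ ≤ Λ) {p : ℕ} (hp : p.Prime) {a : A} (ha : a ∈ Λ) {d : ℤ} (hd : (d : ℚ) = Algebra.norm ℚ a) :
    (∃ b ∈ Λ, ∃ c ∈ Λ, a * b = 1 + (p : ℤ) • c) ↔ ¬ (p : ℤ) ∣ d := by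
  rw [← exists_mul_eq_smul_one_iff_exists_mul_eq_one_add hΛ h1 hΛΛ hp a,
    exists_mul_eq_smul_one_iff_not_dvd hΛ h1 hΛΛ hp ha hd]

/-! ## §3 Lemma 7.5 (a) as printed, for `a ∈ Λ_(p)`: `a ∈ Λ_(p)^{unit} ⟺ det(a) ∈ ℤ_(p)^{unit}` -/

omit [Algebra ℚ A] in
/-- For `p ∤ s`, **`a` is a unit of `Λ_(p)` iff `s·a` is** (`s ∈ ℤ_(p)^{unit}`).
[cite: HertlingLarabi2026, §7 Def. 7.1 (a) («group of units `ℤ_(p)^{unit} = ℤ_(p) − pℤ_(p)`») and Lemma 7.5 (a), chunk p0018] -/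
theorem exists_mul_eq_smul_one_iff_of_smul {Λ : Submodule ℤ A} {p : ℕ} (hp : p.Prime) {a : A} {s : ℤ}
    (hs : ¬ (p : ℤ) ∣ s) :
    (∃ b ∈ Λ, ∃ r : ℤ, ¬ (p : ℤ) ∣ r ∧ a * b = r • (1 : A)) ↔
      ∃ b ∈ Λ, ∃ r : ℤ, ¬ (p : ℤ) ∣ r ∧ (s • a) * b = r • (1 : A) := by
  constructor
  · rintro ⟨b, hb, r, hr, hab⟩
    exact ⟨b, hb, s * r, not_dvd_mul_int' hp hs hr, by rw [smul_mul_assoc, hab, smul_smul]⟩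
  · rintro ⟨b, hb, r, hr, hab⟩
    exact ⟨s • b, Λ.smul_mem s hb, r, hr, by rw [mul_smul_comm, ← smul_mul_assoc, hab]⟩

/-- `det(s·a) = sⁿ·det(a)`, `n = dim_ℚ A`. [cite: HertlingLarabi2026, §7 Lemma 7.5 (a) (proof, «`a ∈ Λ_(p)` implies `det(a) ∈ ℤ_(p)`»), chunk p0018] -/
theorem intCast_pow_mul_norm_eq (s : ℤ) (a : A) :
    ((s ^ finrank ℚ A : ℤ) : ℚ) * Algebra.norm ℚ a = Algebra.norm ℚ (s • a) := by
  rw [← smul_one_mul s a, map_mul, norm_zsmul_one, Int.cast_pow]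

/-- **LEMMA 7.5 (a) AS PRINTED: for `a ∈ Λ_(p)` (`s·a ∈ Λ`, `p ∤ s`; `Λ` a full order),
«`a ∈ Λ_(p)^{unit} ⟺ det(a) ∈ ℤ_(p)^{unit}`»** — `det(a) = r/t` with `p ∤ r`, `p ∤ t`.  (`det(s·a) = sⁿdet(a)` is an
integer, and `a`, `s·a` are local units together.) [cite: HertlingLarabi2026, §7 Lemma 7.5 (a), chunk p0018] -/
theorem exists_mul_eq_smul_one_iff_norm_localUnit {Λ : Submodule ℤ A} (hΛ : IsFullLattice A Λ)
    (h1 : (1 : A) ∈ Λ) (hΛΛ : Λ * Λ ≤ Λ) {p : ℕ} (hp : p.Prime) {a : A} {s : ℤ} (hs : ¬ (p : ℤ) ∣ s)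
    (hsa : s • a ∈ Λ) :
    (∃ b ∈ Λ, ∃ r : ℤ, ¬ (p : ℤ) ∣ r ∧ a * b = r • (1 : A)) ↔
      ∃ r t : ℤ, ¬ (p : ℤ) ∣ r ∧ ¬ (p : ℤ) ∣ t ∧ (t : ℚ) * Algebra.norm ℚ a = r := by
  obtain ⟨d, hd⟩ :=
    exists_intCast_eq_norm hΛ (a := s • a) fun x hx => hΛΛ (Submodule.mul_mem_mul hsa hx)
  have hd' : ((s ^ finrank ℚ A : ℤ) : ℚ) * Algebra.norm ℚ a = d := by rw [intCast_pow_mul_norm_eq, hd]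
  rw [exists_mul_eq_smul_one_iff_of_smul hp hs, exists_mul_eq_smul_one_iff_not_dvd hΛ h1 hΛΛ hp hsa hd]
  constructor
  · exact fun hpd => ⟨d, s ^ finrank ℚ A, hpd, not_dvd_pow_int' hp hs _, hd'⟩
  · rintro ⟨r, t, hr, ht, hrt⟩ hpd
    -- `t·det(s·a) = sⁿ·r`
    have h : t * d = s ^ finrank ℚ A * r := by
      have h1 : (t : ℚ) * d = (s ^ finrank ℚ A : ℤ) * r := by rw [← hd', ← hrt]; ring
      exact_mod_cast h1
    refine not_dvd_mul_int' hp (not_dvd_pow_int' hp hs (finrank ℚ A)) hr ?_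
    rw [← h]
    exact dvd_mul_of_dvd_right hpd t

/-! ## §4 Global corollaries: `a ∈ Λ^{unit} ⟺ det(a) = ±1`; `a ∈ A^{unit} ⟺ det(a) ≠ 0` -/

/-- **`a ∈ Λ^{unit} ⟺ det(a) = ±1`** for `a` in a full order `Λ` with `det(a) = d ∈ ℤ`: `a·b = 1` with `b ∈ Λ` iff
`d` is a unit of `ℤ` («⇒»: `det(a)det(b) = 1` in `ℤ`; «⇐»: `a·(d·y) = d²·1_A = 1_A` for the `y ∈ Λ` of §1) — the
prime-free case of Lemma 7.5 (equivalently: `a ∈ Λ_(p)^{unit}` for every `p`, by `Λ = ⋂_p Λ_(p)`, Thm. 7.2 (a)).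
[cite: HertlingLarabi2026, §7 Lemma 7.5 (a) with Thm. 7.2 (a), chunk p0018] -/
theorem exists_mul_eq_one_iff_isUnit_norm {Λ : Submodule ℤ A} (hΛ : IsFullLattice A Λ) (h1 : (1 : A) ∈ Λ)
    (hΛΛ : Λ * Λ ≤ Λ) {a : A} (ha : a ∈ Λ) {d : ℤ} (hd : (d : ℚ) = Algebra.norm ℚ a) :
    (∃ b ∈ Λ, a * b = 1) ↔ IsUnit d := by
  constructor
  · rintro ⟨b, hb, hab⟩
    obtain ⟨d', hd'⟩ := exists_intCast_eq_norm hΛ (a := b) fun x hx => hΛΛ (Submodule.mul_mem_mul hb hx)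
    have h : d * d' = 1 := by
      have h1 := congrArg (Algebra.norm ℚ) hab
      rw [map_mul, map_one, ← hd, ← hd'] at h1
      exact_mod_cast h1
    exact IsUnit.of_mul_eq_one d' h
  · intro hu
    obtain ⟨y, hy, hay⟩ :=
      exists_mem_mul_eq_norm_smul hΛ (a := a) (fun x hx => hΛΛ (Submodule.mul_mem_mul ha hx)) h1
    refine ⟨d • y, Λ.smul_mem d hy, ?_⟩
    rw [mul_smul_comm, hay, ← hd, Int.cast_smul_eq_zsmul, smul_smul, Int.isUnit_mul_self hu, one_smul]

/-- **`a ∈ Λ^{unit} ⟺ det(a) ∈ {1, −1}`**, determinant form of the previous statement.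
[cite: HertlingLarabi2026, §7 Lemma 7.5 (a) with Thm. 7.2 (a), chunk p0018] -/
theorem exists_mul_eq_one_iff_norm_eq_one_or {Λ : Submodule ℤ A} (hΛ : IsFullLattice A Λ) (h1 : (1 : A) ∈ Λ)
    (hΛΛ : Λ * Λ ≤ Λ) {a : A} (ha : a ∈ Λ) :
    (∃ b ∈ Λ, a * b = 1) ↔ Algebra.norm ℚ a = 1 ∨ Algebra.norm ℚ a = -1 := by
  obtain ⟨d, hd⟩ := exists_intCast_eq_norm hΛ (a := a) fun x hx => hΛΛ (Submodule.mul_mem_mul ha hx)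
  rw [exists_mul_eq_one_iff_isUnit_norm hΛ h1 hΛΛ ha hd, Int.isUnit_iff, ← hd]
  norm_cast

/-- **Local-to-global: `a ∈ Λ^{unit}` iff `a ∈ Λ_(p)^{unit}` for every prime `p`** (`a ∈ Λ`, `Λ` a full order) —
`p ∤ det(a)` for all `p` iff `det(a) = ±1`; cf. `Λ = ⋂_p Λ_(p)` (Thm. 7.2 (a)).
[cite: HertlingLarabi2026, §7 Lemma 7.5 (a) with Thm. 7.2 (a), chunk p0018] -/
theorem exists_mul_eq_one_iff_forall_prime {Λ : Submodule ℤ A} (hΛ : IsFullLattice A Λ) (h1 : (1 : A) ∈ Λ)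
    (hΛΛ : Λ * Λ ≤ Λ) {a : A} (ha : a ∈ Λ) :
    (∃ b ∈ Λ, a * b = 1) ↔
      ∀ p : ℕ, p.Prime → ∃ b ∈ Λ, ∃ r : ℤ, ¬ (p : ℤ) ∣ r ∧ a * b = r • (1 : A) := by
  obtain ⟨d, hd⟩ := exists_intCast_eq_norm hΛ (a := a) fun x hx => hΛΛ (Submodule.mul_mem_mul ha hx)
  rw [exists_mul_eq_one_iff_isUnit_norm hΛ h1 hΛΛ ha hd]
  constructor
  · intro hu p hp
    exact (exists_mul_eq_smul_one_iff_not_dvd hΛ h1 hΛΛ hp ha hd).2 fun h =>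
      (Nat.prime_iff_prime_int.1 hp).not_unit (isUnit_of_dvd_unit h hu)
  · intro h
    rw [Int.isUnit_iff_natAbs_eq]
    by_contra hne
    obtain ⟨p, hp, hpd⟩ := Nat.exists_prime_and_dvd hne
    exact (exists_mul_eq_smul_one_iff_not_dvd hΛ h1 hΛΛ hp ha hd).1 (h p hp) (Int.natCast_dvd.2 hpd)

/-- **`a ∈ A^{unit} ⟺ det(a) ≠ 0`** for a finite-dimensional commutative `ℚ`-algebra `A`: `μ_a` is invertible iff its
determinant is non-zero, and `μ_a` invertible gives `a·y = 1_A`.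
[cite: HertlingLarabi2026b, §7 Rem. 7.3 (ii) («`N(a) := det((multiplication with a) : A → A)`», `a ∈ A^{unit}`), chunk p0015] [cite: HertlingLarabi2026, §7 Lemma 7.5, chunk p0018] -/
theorem isUnit_iff_norm_ne_zero [Module.Finite ℚ A] {a : A} : IsUnit a ↔ Algebra.norm ℚ a ≠ 0 := by
  rw [Algebra.norm_apply, ← isUnit_iff_ne_zero, ← LinearMap.isUnit_iff_isUnit_det]
  constructor
  · exact fun h => h.map (Algebra.lmul ℚ A)
  · rintro ⟨u, hu⟩
    refine IsUnit.of_mul_eq_one ((↑u⁻¹ : Module.End ℚ A) 1) ?_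
    have h := LinearMap.congr_fun u.mul_inv (1 : A)
    rw [Module.End.mul_apply, hu, Module.End.one_apply] at h
    simpa using h

end LocalUnitsNorm

end Literature.NumberTheory.ComplexMultiplication.FiniteQAlgebraLattice
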